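import Summits.CriticalPhenomena.PercolationContinuityZ3.Theorems.Transplant.SkelPhiEquilibriumFacts
import Literature.Probability.Percolation.SharpnessDCTProofs
import HarnessLib

/-!
# N1 (the {±1} node), LEVEL 0, file (L0-3a′): the CO-QUADRANT REGIONS of Martineau–Tassion's Fact 1 (`X_n`, `X`, `∂₁X_n`, `∂₂X_n`, mirrored by a sign
# `σ = ±1` instead of a reflection), the height `ℓ_B(n,h)` clearing the zone box, the four set inclusions of Fact 1 ((16): `C(n,h,ℓ_B) ⊆ X_n`,
# `LR ⊆ ∂₁X_n` ⇒ `evLR ⊆ evX1`; "every path to `∂₂X_n` inside `X_n` crosses `UD`" ⇒ `evX2 ⊆ evUD`; `evX1` decreasing / `evX2` increasing in `n`), the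
# exit lemma for `X`, and the generic "finite open path inside an increasing union lies in one member" (for the monotone limits of (13)/(14)/Fact 2)

builds on p205010 (kernel theorem, internal audit signed; external expert review pending) — nothing in this file uses p205010; nothing is claimed about the
open node `SamePDropOfSkeletonNeg`.  Lane `prim-bschramm`, seat `prim-bschramm-p3` (gen 8; design owner); helper file (`--supports stmt-CriticalPhenomena-4575`);
NEG-SCOPE.md §3 (L0-3); no reflection symmetry is used (the case `h ≤ 0` of the paper is the sign `σ = −1`).
* §1 `exists_openConnIn_of_iUnion` (monotone unions), `seedReach` (the vertices joined to the seed inside a set);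
* §2 `Eq.ℓB n h M` with `mul_ℓB_lt` / `le_mul_ℓB_succ`;
* §3 `Eq.X σ n M`, `Eq.Xinf σ M`, `X1set/X2set/X2inf`, `evX1/evX2/evX2inf`, `X_mono`, `iUnion_X`, **`pgramCyl_ℓB_subset_X`**, **`evLR_subset_evX1`**, **`evX2_subset_evUD`**,
  **`evX1_anti_width`**, `evX2_mono_width`, `evX2_subset_evX2inf`, **`evX2inf_of_exit`** (a seed vertex joined to a vertex outside `X` is joined inside `X` to `∂₂X`).
[cite: MartineauTassion2017, §3.2 Fact 1 (X, ∂X, X_n, ∂₁X_n, ∂₂X_n; (13)–(16))] [cite: GrimmettPercolation1999, §7.3 p. 166 (first crossings)]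
-/

noncomputable section

namespace Summit.CriticalPhenomena.PercolationContinuityZ3.Theorems.Transplant

namespace Skelφ

namespace Eq

open MeasureTheory Literature.Probability.Percolation Literature.Probability.LatticeModels SimpleGraph KNLevels
open scoped Classical

variable {V : Type} {G : SimpleGraph V} (φ : V → Site 2) (t : V)

/-! ## §1 Finite open paths inside an increasing union -/

omit φ t in
/-- **A finite open path inside an increasing union of sets lies inside one of them.** [folklore] -/
theorem exists_openConnIn_of_iUnion {S : ℕ → Set V} (hmono : Monotone S) {ω : BondConfig V} {a z : V} (h : ω ∈ openConnIn (⋃ k, S k) a z) :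
    ∃ k, ω ∈ openConnIn (S k) a z := by
  rw [DCT16.mem_openConnIn_iff_pathIn] at h
  obtain ⟨ha, hpath⟩ := h
  obtain ⟨k₀, hk₀⟩ := Set.mem_iUnion.1 ha
  induction hpath with
  | refl => exact ⟨k₀, DCT16.mem_openConnIn_iff_pathIn.2 (PathIn.refl hk₀)⟩
  | @tail b c _ hbc ih =>
    obtain ⟨k₁, hk₁⟩ := ih
    obtain ⟨k₂, hk₂⟩ := Set.mem_iUnion.1 hbc.2
    refine ⟨max k₁ k₂, ?_⟩
    have h1 : ω ∈ openConnIn (S (max k₁ k₂)) a b := openConnIn_mono (hmono (le_max_left _ _)) a b hk₁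
    have hb : b ∈ S (max k₁ k₂) := (DCT16.mem_openConnIn_iff_pathIn.1 h1).right_mem
    exact PlanarDuality.openConnIn_trans h1 (GM.openConnIn_of_adj hb (hmono (le_max_right _ _) hk₂) hbc.1)

omit φ t in
/-- The set of vertices joined to `a` inside `S`. [folklore] -/
def seedReach (S : Set V) (ω : BondConfig V) (a : V) : Set V := {v | ω ∈ openConnIn S a v}

omit φ t in
/-- Membership in `seedReach`. [folklore] -/
@[simp] theorem mem_seedReach {S : Set V} {ω : BondConfig V} {a v : V} : v ∈ seedReach S ω a ↔ ω ∈ openConnIn S a v := Iff.rfl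

/-! ## §2 The height clearing the zone box -/

omit φ t in
/-- **`ℓ_B(n,h)`**: the least height with `(M+1)·(n+|h|) ≤ n·(ℓ_B + 1)` (Martineau–Tassion's `ℓ_B(n,h) = n_B(1 + |h|/n)`, `n_B = M + 1`, rounded so that the slanted top of
`C(n,h,ℓ_B)` clears the zone square of half-width `M`). [cite: MartineauTassion2017, §3.2 (10)–(11)] -/
def ℓB (n : ℕ) (h : ℤ) (M : ℕ) : ℕ := ((M + 1) * (n + h.natAbs) - 1) / n

omit φ t in
/-- `n·ℓ_B < (M+1)(n+|h|)` (for `n ≥ 1`). [folklore] -/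
theorem mul_ℓB_lt {n : ℕ} (hn : 1 ≤ n) (h : ℤ) (M : ℕ) : n * ℓB n h M < (M + 1) * (n + h.natAbs) := by
  unfold ℓB
  have hk : 1 ≤ (M + 1) * (n + h.natAbs) := Nat.one_le_iff_ne_zero.2 (Nat.mul_ne_zero (by omega) (by omega))
  have := Nat.div_mul_le_self ((M + 1) * (n + h.natAbs) - 1) n
  rw [Nat.mul_comm] at this
  omega

omit φ t in
/-- `(M+1)(n+|h|) ≤ n·(ℓ_B + 1)` (for `n ≥ 1`). [folklore] -/
theorem le_mul_ℓB_succ {n : ℕ} (hn : 1 ≤ n) (h : ℤ) (M : ℕ) : (M + 1) * (n + h.natAbs) ≤ n * (ℓB n h M + 1) := by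
  unfold ℓB
  set k := (M + 1) * (n + h.natAbs) with hk'
  have hk : 1 ≤ k := Nat.one_le_iff_ne_zero.2 (Nat.mul_ne_zero (by omega) (by omega))
  have h1 := Nat.lt_div_mul_add (a := k - 1) (b := n) (by omega)
  rw [Nat.mul_add, Nat.mul_one, Nat.mul_comm n ((k - 1) / n)]
  omega

/-! ## §3 The co-quadrant regions -/

/-- **`X_n^σ`** (`σ = ±1`; `σ = 1` is Martineau–Tassion's `X_n = [−n, n_B) × ℝ ∪ [−n, n] × [−n_B, ∞)`, `σ = −1` its mirror image): `|α| ≤ n` and (`σ·α < M+1` or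
`β ≥ −(M+1)`). [cite: MartineauTassion2017, §3.2 Fact 1 (X_n)] -/
def X (σ : ℤ) (n M : ℕ) : Set V := {w | |relCoord φ t 0 w| ≤ n ∧ (σ * relCoord φ t 0 w < M + 1 ∨ -((M : ℤ) + 1) ≤ relCoord φ t 1 w)}

/-- **`X^σ`** = the union of the `X_n^σ`: `σ·α < M+1` or `β ≥ −(M+1)` (the complement of the quadrant `{σ·α ≥ M+1, β < −(M+1)}`).
[cite: MartineauTassion2017, §3.2 Fact 1 (X)] -/
def Xinf (σ : ℤ) (M : ℕ) : Set V := {w | σ * relCoord φ t 0 w < M + 1 ∨ -((M : ℤ) + 1) ≤ relCoord φ t 1 w}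

/-- `∂₁X_n^σ`: the vertices of `X_n^σ` with `|α| = n`. [cite: MartineauTassion2017, §3.2 (∂₁X_n)] -/
def X1set (σ : ℤ) (n M : ℕ) : Set V := {w | w ∈ X φ t σ n M ∧ |relCoord φ t 0 w| = n}

/-- `∂₂X_n^σ` (thickened inner corner): the vertices of `X_n^σ` with `σ·α ≥ M` and `β ≤ −M`. [cite: MartineauTassion2017, §3.2 (∂₂X_n)] -/
def X2set (σ : ℤ) (n M : ℕ) : Set V := {w | w ∈ X φ t σ n M ∧ (M : ℤ) ≤ σ * relCoord φ t 0 w ∧ relCoord φ t 1 w ≤ -(M : ℤ)}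

/-- `∂X^σ` (thickened): the vertices of `X^σ` with `σ·α ≥ M` and `β ≤ −M`. [cite: MartineauTassion2017, §3.2 (∂X)] -/
def X2inf (σ : ℤ) (M : ℕ) : Set V := {w | w ∈ Xinf φ t σ M ∧ (M : ℤ) ≤ σ * relCoord φ t 0 w ∧ relCoord φ t 1 w ≤ -(M : ℤ)}

/-- Membership in `X_n^σ`. [folklore] -/
@[simp] theorem mem_X {σ : ℤ} {n M : ℕ} {w : V} :
    w ∈ X φ t σ n M ↔ |relCoord φ t 0 w| ≤ n ∧ (σ * relCoord φ t 0 w < M + 1 ∨ -((M : ℤ) + 1) ≤ relCoord φ t 1 w) := Iff.rfl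
/-- Membership in `X^σ`. [folklore] -/
@[simp] theorem mem_Xinf {σ : ℤ} {M : ℕ} {w : V} : w ∈ Xinf φ t σ M ↔ σ * relCoord φ t 0 w < M + 1 ∨ -((M : ℤ) + 1) ≤ relCoord φ t 1 w := Iff.rfl
/-- Membership in `∂₁X_n^σ`. [folklore] -/
@[simp] theorem mem_X1set {σ : ℤ} {n M : ℕ} {w : V} : w ∈ X1set φ t σ n M ↔ w ∈ X φ t σ n M ∧ |relCoord φ t 0 w| = n := Iff.rfl
/-- Membership in `∂₂X_n^σ`. [folklore] -/
@[simp] theorem mem_X2set {σ : ℤ} {n M : ℕ} {w : V} :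
    w ∈ X2set φ t σ n M ↔ w ∈ X φ t σ n M ∧ (M : ℤ) ≤ σ * relCoord φ t 0 w ∧ relCoord φ t 1 w ≤ -(M : ℤ) := Iff.rfl
/-- Membership in `∂X^σ`. [folklore] -/
@[simp] theorem mem_X2inf {σ : ℤ} {M : ℕ} {w : V} :
    w ∈ X2inf φ t σ M ↔ w ∈ Xinf φ t σ M ∧ (M : ℤ) ≤ σ * relCoord φ t 0 w ∧ relCoord φ t 1 w ≤ -(M : ℤ) := Iff.rfl

/-- `SEED ↔ ∂₁X_n inside X_n`. [cite: MartineauTassion2017, §3.2 (13)] -/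
def evX1 (SEED : Set V) (σ : ℤ) (n M : ℕ) : Set (BondConfig V) := openCrossing (X φ t σ n M) SEED (X1set φ t σ n M)

/-- `SEED ↔ ∂₂X_n inside X_n`. [cite: MartineauTassion2017, §3.2 (14)] -/
def evX2 (SEED : Set V) (σ : ℤ) (n M : ℕ) : Set (BondConfig V) := openCrossing (X φ t σ n M) SEED (X2set φ t σ n M)

/-- `SEED ↔ ∂X inside X`. [cite: MartineauTassion2017, §3.2 (14)–(15)] -/
def evX2inf (SEED : Set V) (σ : ℤ) (M : ℕ) : Set (BondConfig V) := openCrossing (Xinf φ t σ M) SEED (X2inf φ t σ M)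

/-- `X_n ⊆ X_{n'}` for `n ≤ n'`. [folklore] -/
theorem X_mono (σ : ℤ) (M : ℕ) {n n' : ℕ} (hn : n ≤ n') : X φ t σ n M ⊆ X φ t σ n' M :=
  fun _ hw => ⟨hw.1.trans (by exact_mod_cast hn), hw.2⟩

/-- `X_n ⊆ X`. [folklore] -/
theorem X_subset_Xinf (σ : ℤ) (n M : ℕ) : X φ t σ n M ⊆ Xinf φ t σ M := fun _ hw => hw.2

/-- `X = ⋃ X_n`. [folklore] -/
theorem iUnion_X (σ : ℤ) (M : ℕ) : (⋃ n, X φ t σ n M) = Xinf φ t σ M := by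
  ext w
  simp only [Set.mem_iUnion, mem_X, mem_Xinf]
  exact ⟨fun ⟨_, _, h2⟩ => h2, fun h2 => ⟨(relCoord φ t 0 w).natAbs, by rw [Int.natCast_natAbs], h2⟩⟩

/-- `X_n` lies in the strip `|α| ≤ n`. [folklore] -/
theorem X_subset_strip (σ : ℤ) (n M : ℕ) : X φ t σ n M ⊆ strip φ t n := fun _ hw => hw.1

/-- **(16a) `C(n, h, ℓ_B) ⊆ X_n^σ`** when `σ·h = |h|` (`n ≥ 1`): a point of the parallelogram with `σ·α ≥ M+1` has `β > −(M+1)`. [cite: MartineauTassion2017, §3.2 (16)] -/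
theorem pgramCyl_ℓB_subset_X {σ : ℤ} (hσ : σ = 1 ∨ σ = -1) {n : ℕ} (hn : 1 ≤ n) {h : ℤ} (hσh : σ * h = |h|) (M : ℕ) :
    pgramCyl φ t n h (ℓB n h M) ⊆ X φ t σ n M := by
  intro w hw
  rw [mem_pgramCyl] at hw
  obtain ⟨hα, hβ'⟩ := hw
  refine ⟨hα, ?_⟩
  by_contra hcon
  rw [not_or, not_lt, not_le] at hcon
  obtain ⟨hαM, hβM⟩ := hcon
  have hlt : ((n * ℓB n h M : ℕ) : ℤ) < (((M + 1) * (n + h.natAbs) : ℕ) : ℤ) := by exact_mod_cast mul_ℓB_lt hn h M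
  push_cast [Int.natCast_natAbs] at hlt
  have hsc := shearCoord_apply φ t n h w
  have hlow := (abs_le.1 hβ').1
  simp only [shearCoord_apply, relCoord_apply] at hlow hαM hβM
  -- `h·α = |h|·(σ·α) ≥ |h|·(M+1)`
  have hσ2 : σ * σ = 1 := by rcases hσ with rfl | rfl <;> norm_num
  have hhα : h * (φ w 0 - φ t 0) = |h| * (σ * (φ w 0 - φ t 0)) := by
    rw [← hσh]; calc h * (φ w 0 - φ t 0) = (σ * σ) * h * (φ w 0 - φ t 0) := by rw [hσ2, one_mul]
      _ = σ * h * (σ * (φ w 0 - φ t 0)) := by ring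
  have h1 : |h| * ((M : ℤ) + 1) ≤ |h| * (σ * (φ w 0 - φ t 0)) := mul_le_mul_of_nonneg_left hαM (abs_nonneg h)
  have hn0 : (0 : ℤ) < n := by exact_mod_cast hn
  -- `nβ ≥ hα − nℓ_B > |h|(M+1) − (M+1)(n+|h|) = −(M+1)n`
  nlinarith

/-- **(16b) `evLR(n,h,ℓ_B) ⊆ evX1_n^σ`.** [cite: MartineauTassion2017, §3.2 (16)] -/
theorem evLR_subset_evX1 {σ : ℤ} (hσ : σ = 1 ∨ σ = -1) {n : ℕ} (hn : 1 ≤ n) {h : ℤ} (hσh : σ * h = |h|) (M : ℕ) (SEED : Set V) :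
    evLR φ t SEED n h (ℓB n h M) ⊆ evX1 φ t SEED σ n M :=
  openCrossing_mono (pgramCyl_ℓB_subset_X φ t hσ hn hσh M) le_rfl fun _ hw => ⟨pgramCyl_ℓB_subset_X φ t hσ hn hσh M hw.1, hw.2⟩

/-- **(16c) `evX2_n^σ ⊆ evUD(n,h,ℓ_B)`** (seed inside `C(n,h,ℓ_B)`, lattice configurations): every open path inside `X_n` from the seed to `∂₂X_n` crosses the bottom
layer of `C(n,h,ℓ_B)` — the target is beyond the interior (`β′ ≤ −M(n+|h|) < −nℓ_B + (n+|h|)`). [cite: MartineauTassion2017, §3.2 (16) ("each path … has to cross UD")] -/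
theorem evX2_subset_evUD (hlip : Lip G φ) {σ : ℤ} (hσ : σ = 1 ∨ σ = -1) {n : ℕ} (hn : 1 ≤ n) {h : ℤ} (hσh : σ * h = |h|) {M : ℕ} {SEED : Set V}
    (hS : SEED ⊆ pgramCyl φ t n h (ℓB n h M)) {ω : BondConfig V} (hω : ω ⊆ G.edgeSet) (h2 : ω ∈ evX2 φ t SEED σ n M) :
    ω ∈ evUD φ t SEED n h (ℓB n h M) := by
  obtain ⟨a, ha, w, hw, hconn⟩ := h2
  refine evUD_of_openConnIn_not_inner φ t hlip (S' := X φ t σ n M) (fun v hv => hv.1) hω ha (hS ha) ?_ hconn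
  intro hwI
  rw [mem_inner] at hwI
  obtain ⟨-, hαM, hβM⟩ := (mem_X2set φ t).1 hw
  have hlt : ((n * ℓB n h M : ℕ) : ℤ) < (((M + 1) * (n + h.natAbs) : ℕ) : ℤ) := by exact_mod_cast mul_ℓB_lt hn h M
  have hup := (abs_le.1 hwI.2).1
  push_cast [Int.natCast_natAbs] at hlt hup
  simp only [shearCoord_apply, relCoord_apply] at hup hαM hβM
  have hσ2 : σ * σ = 1 := by rcases hσ with rfl | rfl <;> norm_num
  have hhα : h * (φ w 0 - φ t 0) = |h| * (σ * (φ w 0 - φ t 0)) := by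
    rw [← hσh]; calc h * (φ w 0 - φ t 0) = (σ * σ) * h * (φ w 0 - φ t 0) := by rw [hσ2, one_mul]
      _ = σ * h * (σ * (φ w 0 - φ t 0)) := by ring
  have h1 : |h| * (M : ℤ) ≤ |h| * (σ * (φ w 0 - φ t 0)) := mul_le_mul_of_nonneg_left hαM (abs_nonneg h)
  have hn0 : (0 : ℤ) < n := by exact_mod_cast hn
  nlinarith

/-- **(13) `evX1` is decreasing in the width** (lattice configurations, seed inside the zone square `{|α| ≤ M, β ≥ −M}` ⊆ X_n for `n ≥ M`).
[cite: MartineauTassion2017, §3.2 (13) ("the sequence … is decreasing")] -/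
theorem evX1_anti_width (hlip : Lip G φ) {σ : ℤ} {M n n' : ℕ} (hMn : M ≤ n) (hn : n ≤ n') {SEED : Set V} (hS : SEED ⊆ cyl φ t M)
    {ω : BondConfig V} (hω : ω ⊆ G.edgeSet) (h1 : ω ∈ evX1 φ t SEED σ n' M) : ω ∈ evX1 φ t SEED σ n M := by
  obtain ⟨a, ha, w, hw, hconn⟩ := h1
  have haX : a ∈ X φ t σ n M := by
    have hac := hS ha
    rw [mem_cyl, mem_box] at hac
    have h0 := hac 0; have h1' := hac 1
    simp only [Pi.sub_apply] at h0 h1'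
    refine ⟨?_, Or.inr ?_⟩
    · rw [relCoord_apply, abs_le]; constructor <;> omega
    · rw [relCoord_apply]; omega
  rcases Nat.eq_or_lt_of_le hn with rfl | hlt
  · exact ⟨a, ha, w, hw, hconn⟩
  have hwX : w ∉ X φ t σ n M := by
    intro hw'
    have := ((mem_X1set φ t).1 hw).2
    have := hw'.1
    omega
  obtain ⟨z, hz, u, hu, huX, hzu, haz⟩ := TwoAxis.exists_exit_of_openConnIn (S := X φ t σ n M) haX hwX hconn
  have hadj : G.Adj z u := hω ((openGraph_adj ω z u).1 hzu).1
  obtain ⟨hα1, -⟩ := shearCoord_sub_le_of_adj hlip hadj t n (0 : ℤ)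
  -- `u ∈ X_{n'} \ X_n` forces `|α u| > n`, hence `|α z| = n`
  have hαu : (n : ℤ) < |relCoord φ t 0 u| := by
    by_contra hle
    exact huX ⟨not_lt.1 hle, hu.2⟩
  have hd := abs_sub_abs_le_abs_sub (relCoord φ t 0 u) (relCoord φ t 0 z)
  rw [abs_sub_comm] at hd
  have hzn : |relCoord φ t 0 z| = n := le_antisymm hz.1 (Int.lt_add_one_iff.mp (by linarith))
  exact ⟨a, ha, z, ⟨hz, hzn⟩, haz⟩

/-- (14) `evX2` is increasing in the width. [cite: MartineauTassion2017, §3.2 (14)] -/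
theorem evX2_mono_width (σ : ℤ) (M : ℕ) {n n' : ℕ} (hn : n ≤ n') (SEED : Set V) : evX2 φ t SEED σ n M ⊆ evX2 φ t SEED σ n' M :=
  openCrossing_mono (X_mono φ t σ M hn) le_rfl fun _ hw => ⟨X_mono φ t σ M hn hw.1, hw.2⟩

/-- `evX2_n ⊆ evX2∞`. [folklore] -/
theorem evX2_subset_evX2inf (σ : ℤ) (n M : ℕ) (SEED : Set V) : evX2 φ t SEED σ n M ⊆ evX2inf φ t SEED σ M :=
  openCrossing_mono (X_subset_Xinf φ t σ n M) le_rfl fun _ hw => ⟨X_subset_Xinf φ t σ n M hw.1, hw.2⟩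

/-- `evX2∞ ⊆ ⋃ evX2_n` (a finite open path inside `X` lies inside some `X_n`). [folklore] -/
theorem evX2inf_subset_iUnion (σ : ℤ) (M : ℕ) (SEED : Set V) : evX2inf φ t SEED σ M ⊆ ⋃ n, evX2 φ t SEED σ n M := by
  rintro ω ⟨a, ha, w, hw, hconn⟩
  rw [← iUnion_X] at hconn
  obtain ⟨k, hk⟩ := exists_openConnIn_of_iUnion (fun n n' hn => X_mono φ t σ M hn) hconn
  have hwX : w ∈ X φ t σ k M := (DCT16.mem_openConnIn_iff_pathIn.1 hk).right_mem
  exact Set.mem_iUnion.2 ⟨k, a, ha, w, ⟨hwX, hw.2⟩, hk⟩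

/-- **Exit from `X`**: a seed vertex of `X` joined (inside any ambient set) to a vertex OUTSIDE `X` is joined inside `X` to `∂X` (the last vertex before the quadrant
`{σ·α ≥ M+1, β < −(M+1)}` has `σ·α ≥ M`, `β ≤ −M`). [cite: MartineauTassion2017, §3.1 Lemma 3.1, §3.2 (15)] -/
theorem evX2inf_of_exit (hlip : Lip G φ) {σ : ℤ} (hσ : σ = 1 ∨ σ = -1) {M : ℕ} {SEED : Set V} {S' : Set V} {ω : BondConfig V} (hω : ω ⊆ G.edgeSet)
    {a y : V} (ha : a ∈ SEED) (haX : a ∈ Xinf φ t σ M) (hy : y ∉ Xinf φ t σ M) (hconn : ω ∈ openConnIn S' a y) : ω ∈ evX2inf φ t SEED σ M := by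
  obtain ⟨z, hz, u, -, huX, hzu, haz⟩ := TwoAxis.exists_exit_of_openConnIn (S := Xinf φ t σ M) haX hy hconn
  have hadj : G.Adj z u := hω ((openGraph_adj ω z u).1 hzu).1
  have h0 := hlip hadj 0
  have h1 := hlip hadj 1
  rw [mem_Xinf, not_or, not_lt, not_le] at huX
  obtain ⟨hαu, hβu⟩ := huX
  refine ⟨a, ha, z, ⟨hz, ?_, ?_⟩, haz⟩
  · simp only [relCoord_apply] at hαu ⊢
    have hs : |σ| = 1 := by rcases hσ with rfl | rfl <;> simp
    have : |σ * (φ z 0 - φ t 0) - σ * (φ u 0 - φ t 0)| ≤ 1 := by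
      rw [← mul_sub, abs_mul, hs, one_mul, show φ z 0 - φ t 0 - (φ u 0 - φ t 0) = φ z 0 - φ u 0 by ring]
      exact h0
    have := (abs_le.1 this).1
    linarith
  · simp only [relCoord_apply] at hβu ⊢
    have := (abs_le.1 h1).2
    linarith

end Eq

end Skelφ

end Summit.CriticalPhenomena.PercolationContinuityZ3.Theorems.Transplant

end
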